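import Summits.KontsevichZagierPeriods.KontsevichZagierPeriods.Theorems.SoloInformedStacking
import HarnessLib
import HarnessLib.Audit

/-!
# SoloInformed — density removal for the integrand-additivity moves; `KontsevichZagierPeriods ↔ STABLE-H3` (COROLLARY NF.2, file D2 = tree file `SoloInformedDensityAdd`)

Solo programme `solo-KontsevichZagierPeriods-informed`, session s247 (K-NF.2, files D2 + E).

**Rule (1b).**  For `r = [σ, f]`, `rᵢ = [σ, fᵢ]` with `f = f₁ + f₂` on `σ`:

  `sub[r] − sub[r₁] − sub[r₂] ∈ 𝒮`   (`soloInformed_sub_mem_scissorsRel_of_integrandAdd`),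

`sub[s] = [U(s)] − [U(−s)]` the signed region under the graph, `𝒮 = soloInformedScissorsRel`.
*Proof (no sign cells).*  `sub[s] ≡ [U(s⁺)] − [U((−s)⁺)]` (positive parts, tree file
`SoloInformedStacking`), and on `σ`

  `f⁺ + f₁⁻ + f₂⁻ = f⁻ + f₁⁺ + f₂⁺`      (`g⁺ = max(g,0)`, `g⁻ = max(−g,0)`, from `f = f₁ + f₂`),

both sides sums of NON-NEGATIVE `ℚ`-semialgebraic functions.  On the common smooth locus `G ⊆ σ` of
the six parts (open, conull; tree file `SoloInformedSmoothLocus`) the stacking lemma gives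
`[U(f⁺ + f₁⁻ + f₂⁻)] ≡ [U(f⁺)] + [U(f₁⁻)] + [U(f₂⁻)]` and likewise for the right side, and the two
left members coincide; `σ ∖ G` is null and is cut away by scissors.

**Assembly (file E).**  With rules (1a) (tree file `SoloInformedUnderGraph`) and (2) (tree file
`SoloInformedDensityCoV`) this proves DENSITY REMOVAL `soloInformed_densityRemoval :
SoloInformedDensityRemoval` (`sub` maps `relations₁₂` into `𝒮`), hence the unconditional kernel
equivalence

  `soloInformed_summit_iff_stableH3 : KontsevichZagierPeriods ↔ SoloInformedStableH3`

— the Kontsevich–Zagier period conjecture is equivalent to STABLE-H3: *two finite unions of compact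
basic `ℚ`-semialgebraic cells (volume representations) of equal volume become scissors congruent —
congruent modulo cutting along `ℚ`-semialgebraic sets and `ℚ`-semialgebraic volume-preserving
(`|det| = 1`) injections — after multiplying both by a cube `[0,1]^k`.*

References: M. Kontsevich, D. Zagier, *Periods* (2001), §1.2 and Problem 1; J. Cresson, J. Viu-Sos,
JTNB 34 (2022), Thm. 5.1; J. Ayoub, *Une version relative de la conjecture des périodes de
Kontsevich–Zagier*, Ann. Math. 181 (2015) (motivation); this work, `paper/nl-elimination.md`
COROLLARY NF.2.
-/

noncomputable section

open scoped BigOperators Topology ContDiff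

namespace Summit.KontsevichZagierPeriods.KontsevichZagierPeriods.Theorems

open Set MeasureTheory Function
open Literature.ModelTheory.ExponentialFields
open Literature.NumberTheory.Transcendental Literature.NumberTheory.Transcendental.KZ

variable {n : ℕ}

/-! ### Sums of representations on a common domain -/

/-- `[σ, u + v]` for `[σ, u]`, `[σ, v]`. -/
def soloInformedAddRep (u v : IntegralRep n) (h : v.domain = u.domain) : IntegralRep n where
  domain := u.domain
  integrand := fun x => u.integrand x + v.integrand x
  isSemialgebraic_domain := u.isSemialgebraic_domain
  isSemialgebraicFunOn_integrand :=
    IsSemialgebraicFunOn.add_holds u.isSemialgebraicFunOn_integrand (h ▸ v.isSemialgebraicFunOn_integrand)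
  integrableOn := u.integrableOn.add (h ▸ v.integrableOn)

/-- The domain of `[σ, u + v]`. -/
@[simp] theorem soloInformed_addRep_domain (u v : IntegralRep n) (h : v.domain = u.domain) :
    (soloInformedAddRep u v h).domain = u.domain :=
  rfl

/-- The integrand of `[σ, u + v]`. -/
@[simp] theorem soloInformed_addRep_integrand (u v : IntegralRep n) (h : v.domain = u.domain)
    (x : Fin n → ℝ) : (soloInformedAddRep u v h).integrand x = u.integrand x + v.integrand x :=
  rfl

/-! ### The six parts `f^±, f₁^±, f₂^±` and their common smooth locus -/

/-- The six parts `(max(f,0), max(−f,0), max(f₁,0), max(−f₁,0), max(f₂,0), max(−f₂,0))` as one map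
`ℝⁿ → ℝ⁶`. -/
def soloInformedSixParts (f f₁ f₂ : (Fin n → ℝ) → ℝ) : (Fin n → ℝ) → (Fin 6 → ℝ) :=
  fun x => ![max (f x) 0, max (-f x) 0, max (f₁ x) 0, max (-f₁ x) 0, max (f₂ x) 0, max (-f₂ x) 0]

/-- The six parts form a `ℚ`-semialgebraic map. [Bochnak–Coste–Roy 1998, Prop. 2.2.6] -/
theorem soloInformed_isSemialgebraicMapOn_sixParts {σ : Set (Fin n → ℝ)} (hσ : IsSemialgebraic ℚ σ)
    {f f₁ f₂ : (Fin n → ℝ) → ℝ} (hf : IsSemialgebraicFunOn ℚ σ f) (hf₁ : IsSemialgebraicFunOn ℚ σ f₁)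
    (hf₂ : IsSemialgebraicFunOn ℚ σ f₂) : IsSemialgebraicMapOn ℚ σ (soloInformedSixParts f f₁ f₂) := by
  refine IsSemialgebraicMapOn.of_forall hσ fun j => ?_
  fin_cases j
  exacts [soloInformed_isSemialgebraicFunOn_posPart hσ hf, soloInformed_isSemialgebraicFunOn_posPart hσ hf.neg,
    soloInformed_isSemialgebraicFunOn_posPart hσ hf₁, soloInformed_isSemialgebraicFunOn_posPart hσ hf₁.neg,
    soloInformed_isSemialgebraicFunOn_posPart hσ hf₂, soloInformed_isSemialgebraicFunOn_posPart hσ hf₂.neg]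

/-- A `C^∞` function on an open set is differentiable at its points. -/
theorem soloInformed_hasFDerivAt_of_contDiffOn' {G : Set (Fin n → ℝ)} (hGo : IsOpen G)
    {g : (Fin n → ℝ) → ℝ} (hg : ContDiffOn ℝ ∞ g G) {x : Fin n → ℝ} (hx : x ∈ G) :
    HasFDerivAt g (fderiv ℝ g x) x :=
  (((hg.differentiableOn (by simp)) x hx).differentiableAt (hGo.mem_nhds hx)).hasFDerivAt

/-! ### Rule (1b) on the smooth locus -/

/-- **Rule (1b) on a common smooth locus.**  `a = [G, f]`, `aᵢ = [G, fᵢ]`, `f = f₁ + f₂` on the open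
set `G` on which the six parts are `C^∞`:  `sub[a] − sub[a₁] − sub[a₂] ∈ 𝒮`.  See the module
docstring (`f⁺ + f₁⁻ + f₂⁻ = f⁻ + f₁⁺ + f₂⁺`, four stackings). [this work, COROLLARY NF.2] -/
theorem soloInformed_sub_integrandAdd_smooth (a a₁ a₂ : IntegralRep n) (hGo : IsOpen a.domain)
    (h₁ : a₁.domain = a.domain) (h₂ : a₂.domain = a.domain)
    (hadd : ∀ x ∈ a.domain, a.integrand x = a₁.integrand x + a₂.integrand x)
    (hsm : ContDiffOn ℝ ∞ (soloInformedSixParts a.integrand a₁.integrand a₂.integrand) a.domain) :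
    soloInformedSub (of a) - soloInformedSub (of a₁) - soloInformedSub (of a₂) ∈
      soloInformedScissorsRel := by
  -- the six parts as representations on `G = a.domain`
  set P := soloInformedPosPart a with hP_def
  set N := soloInformedPosPart a.neg with hN_def
  set P₁ := soloInformedPosPart a₁ with hP₁_def
  set N₁ := soloInformedPosPart a₁.neg with hN₁_def
  set P₂ := soloInformedPosPart a₂ with hP₂_def
  set N₂ := soloInformedPosPart a₂.neg with hN₂_def
  -- differentiability of the parts at the points of `G`
  have hsm' := contDiffOn_pi.mp hsm
  have hdP : ∀ x ∈ a.domain, HasFDerivAt P.integrand (fderiv ℝ P.integrand x) x := fun x hx =>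
    soloInformed_hasFDerivAt_of_contDiffOn' hGo (hsm' 0) hx
  have hdN : ∀ x ∈ a.domain, HasFDerivAt N.integrand (fderiv ℝ N.integrand x) x := fun x hx =>
    soloInformed_hasFDerivAt_of_contDiffOn' hGo (hsm' 1) hx
  have hdP₁ : ∀ x ∈ a.domain, HasFDerivAt P₁.integrand (fderiv ℝ P₁.integrand x) x := fun x hx =>
    soloInformed_hasFDerivAt_of_contDiffOn' hGo (hsm' 2) hx
  have hdN₁ : ∀ x ∈ a.domain, HasFDerivAt N₁.integrand (fderiv ℝ N₁.integrand x) x := fun x hx =>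
    soloInformed_hasFDerivAt_of_contDiffOn' hGo (hsm' 3) hx
  -- the stacked representations
  set RA' := soloInformedAddRep P N₁ (h₁.trans rfl) with hRA'_def
  set RA := soloInformedAddRep RA' N₂ (h₂.trans rfl) with hRA_def
  set RB' := soloInformedAddRep N P₁ (h₁.trans rfl) with hRB'_def
  set RB := soloInformedAddRep RB' P₂ (h₂.trans rfl) with hRB_def
  have hP0 := soloInformed_posPart_integrand_nonneg a
  have hN0 := soloInformed_posPart_integrand_nonneg a.neg
  have hP₁0 := soloInformed_posPart_integrand_nonneg a₁
  have hN₁0 := soloInformed_posPart_integrand_nonneg a₁.neg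
  have hP₂0 := soloInformed_posPart_integrand_nonneg a₂
  have hN₂0 := soloInformed_posPart_integrand_nonneg a₂.neg
  -- four stackings
  have S1 : of (soloInformedUnder RA') - of (soloInformedUnder P) - of (soloInformedUnder N₁) ∈
      soloInformedScissorsRel :=
    soloInformed_under_stack_mem_scissorsRel RA' P N₁ rfl h₁ (fun _ _ => rfl) (fun x _ => hP0 x)
      (fun x _ => hN₁0 x) hdP
  have S2 : of (soloInformedUnder RA) - of (soloInformedUnder RA') - of (soloInformedUnder N₂) ∈
      soloInformedScissorsRel :=
    soloInformed_under_stack_mem_scissorsRel RA RA' N₂ rfl h₂ (fun _ _ => rfl)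
      (fun x _ => add_nonneg (hP0 x) (hN₁0 x)) (fun x _ => hN₂0 x)
      (fun x hx => (hdP x hx).add (hdN₁ x hx))
  have S3 : of (soloInformedUnder RB') - of (soloInformedUnder N) - of (soloInformedUnder P₁) ∈
      soloInformedScissorsRel :=
    soloInformed_under_stack_mem_scissorsRel RB' N P₁ rfl h₁ (fun _ _ => rfl) (fun x _ => hN0 x)
      (fun x _ => hP₁0 x) hdN
  have S4 : of (soloInformedUnder RB) - of (soloInformedUnder RB') - of (soloInformedUnder P₂) ∈
      soloInformedScissorsRel :=
    soloInformed_under_stack_mem_scissorsRel RB RB' P₂ rfl h₂ (fun _ _ => rfl)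
      (fun x _ => add_nonneg (hN0 x) (hP₁0 x)) (fun x _ => hP₂0 x)
      (fun x hx => (hdN x hx).add (hdP₁ x hx))
  -- the two stacks coincide: `f⁺ + f₁⁻ + f₂⁻ = f⁻ + f₁⁺ + f₂⁺` on `G`
  have D : of (soloInformedUnder RA) - of (soloInformedUnder RB) ∈ soloInformedScissorsRel := by
    refine soloInformed_of_sub_of_mem_scissorsRel_of_domain_eq (soloInformed_isVolRep_under RA)
      (soloInformed_isVolRep_under RB) ?_
    ext z
    rw [soloInformed_mem_under_domain, soloInformed_mem_under_domain]
    have key : ∀ x ∈ a.domain, RA.integrand x = RB.integrand x := fun x hx => by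
      simp only [hRA_def, hRA'_def, hRB_def, hRB'_def, soloInformed_addRep_integrand, hP_def, hN_def,
        hP₁_def, hN₁_def, hP₂_def, hN₂_def]
      have e := soloInformed_posPart_integrand_sub a x
      have e₁ := soloInformed_posPart_integrand_sub a₁ x
      have e₂ := soloInformed_posPart_integrand_sub a₂ x
      have h := hadd x hx
      linarith
    constructor
    · rintro ⟨hx, h0, h⟩
      exact ⟨hx, h0, (key _ hx) ▸ h⟩
    · rintro ⟨hx, h0, h⟩
      exact ⟨hx, h0, (key _ hx).symm ▸ h⟩
  -- `sub` versus positive parts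
  have E0 := soloInformed_sub_of_sub_posPart_mem a
  have E1 := soloInformed_sub_of_sub_posPart_mem a₁
  have E2 := soloInformed_sub_of_sub_posPart_mem a₂
  -- assemble
  have : soloInformedSub (of a) - soloInformedSub (of a₁) - soloInformedSub (of a₂)
      = (soloInformedSub (of a) - (of (soloInformedUnder P) - of (soloInformedUnder N)))
        - (soloInformedSub (of a₁) - (of (soloInformedUnder P₁) - of (soloInformedUnder N₁)))
        - (soloInformedSub (of a₂) - (of (soloInformedUnder P₂) - of (soloInformedUnder N₂)))
        - (of (soloInformedUnder RA') - of (soloInformedUnder P) - of (soloInformedUnder N₁))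
        - (of (soloInformedUnder RA) - of (soloInformedUnder RA') - of (soloInformedUnder N₂))
        + (of (soloInformedUnder RB') - of (soloInformedUnder N) - of (soloInformedUnder P₁))
        + (of (soloInformedUnder RB) - of (soloInformedUnder RB') - of (soloInformedUnder P₂))
        + (of (soloInformedUnder RA) - of (soloInformedUnder RB)) := by abel
  rw [this]
  exact add_mem (add_mem (add_mem (sub_mem (sub_mem (sub_mem (sub_mem E0 E1) E2) S1) S2) S3) S4) D

/-! ### Rule (1b) -/

/-- **Density removal for rule (1b).**  `r = [σ, f]`, `rᵢ = [σ, fᵢ]`, `f = f₁ + f₂` on `σ`: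
`sub[r] − sub[r₁] − sub[r₂] ∈ 𝒮` (cut away the null complement of the common smooth locus of the
six parts, then `soloInformed_sub_integrandAdd_smooth`). [this work, COROLLARY NF.2] -/
theorem soloInformed_sub_mem_scissorsRel_of_integrandAdd (r r₁ r₂ : IntegralRep n)
    (h₁ : r₁.domain = r.domain) (h₂ : r₂.domain = r.domain)
    (hadd : EqOn r.integrand (r₁.integrand + r₂.integrand) r.domain) :
    soloInformedSub (of r) - soloInformedSub (of r₁) - soloInformedSub (of r₂) ∈
      soloInformedScissorsRel := by
  -- the common smooth locus `G` of the six parts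
  obtain ⟨G, hGσ, hGo, hGsa, hsm, hQsa, hQnull⟩ := soloInformed_exists_isOpen_contDiffOn_map
    r.isSemialgebraic_domain (soloInformed_isSemialgebraicMapOn_sixParts r.isSemialgebraic_domain
      r.isSemialgebraicFunOn_integrand (h₁ ▸ r₁.isSemialgebraicFunOn_integrand)
      (h₂ ▸ r₂.isSemialgebraicFunOn_integrand))
  have hGσ₁ : G ⊆ r₁.domain := by rw [h₁]; exact hGσ
  have hGσ₂ : G ⊆ r₂.domain := by rw [h₂]; exact hGσ
  have hQσ : r.domain \ G ⊆ r.domain := Set.sdiff_subset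
  have hQσ₁ : r.domain \ G ⊆ r₁.domain := by rw [h₁]; exact Set.sdiff_subset
  have hQσ₂ : r.domain \ G ⊆ r₂.domain := by rw [h₂]; exact Set.sdiff_subset
  have hcov : r.domain = G ∪ (r.domain \ G) := (Set.union_sdiff_cancel hGσ).symm
  have hint : volume (G ∩ (r.domain \ G)) = 0 := by
    rw [show G ∩ (r.domain \ G) = ∅ from Set.inter_sdiff_self _ _, measure_empty]
  -- cuts
  have C0 := soloInformed_sub_restrict_mem_scissorsRel r hGsa hQsa hGσ hQσ hcov hint
  have C1 := soloInformed_sub_restrict_mem_scissorsRel r₁ hGsa hQsa hGσ₁ hQσ₁ (h₁.trans hcov) hint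
  have C2 := soloInformed_sub_restrict_mem_scissorsRel r₂ hGsa hQsa hGσ₂ hQσ₂ (h₂.trans hcov) hint
  -- null pieces
  have Z0 := soloInformed_sub_of_mem_scissorsRel_of_volume_eq_zero (r.restrict _ hQsa hQσ) hQnull
  have Z1 := soloInformed_sub_of_mem_scissorsRel_of_volume_eq_zero (r₁.restrict _ hQsa hQσ₁) hQnull
  have Z2 := soloInformed_sub_of_mem_scissorsRel_of_volume_eq_zero (r₂.restrict _ hQsa hQσ₂) hQnull
  -- smooth pieces
  have M := soloInformed_sub_integrandAdd_smooth (r.restrict G hGsa hGσ) (r₁.restrict G hGsa hGσ₁)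
    (r₂.restrict G hGsa hGσ₂) hGo rfl rfl (fun x hx => hadd (hGσ hx)) (hsm.congr fun _ _ => rfl)
  -- assemble
  have : soloInformedSub (of r) - soloInformedSub (of r₁) - soloInformedSub (of r₂)
      = (soloInformedSub (of r) - soloInformedSub (of (r.restrict G hGsa hGσ)) -
          soloInformedSub (of (r.restrict _ hQsa hQσ)))
        - (soloInformedSub (of r₁) - soloInformedSub (of (r₁.restrict G hGsa hGσ₁)) -
          soloInformedSub (of (r₁.restrict _ hQsa hQσ₁)))
        - (soloInformedSub (of r₂) - soloInformedSub (of (r₂.restrict G hGsa hGσ₂)) -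
          soloInformedSub (of (r₂.restrict _ hQsa hQσ₂)))
        + (soloInformedSub (of (r.restrict G hGsa hGσ)) - soloInformedSub (of (r₁.restrict G hGsa hGσ₁))
            - soloInformedSub (of (r₂.restrict G hGsa hGσ₂)))
        + soloInformedSub (of (r.restrict _ hQsa hQσ)) - soloInformedSub (of (r₁.restrict _ hQsa hQσ₁))
        - soloInformedSub (of (r₂.restrict _ hQsa hQσ₂)) := by abel
  rw [this]
  exact sub_mem (sub_mem (add_mem (add_mem (sub_mem (sub_mem C0 C1) C2) M) Z0) Z1) Z2

/-- **Density removal for the moves (1b)**: `sub` of an integrand-additivity relation lies in `𝒮`.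
[Kontsevich–Zagier 2001, §1.2 rule (1); this work, COROLLARY NF.2] -/
theorem soloInformed_sub_mem_scissorsRel_of_mem_integrandAddRel {c : FormalRep}
    (hc : c ∈ integrandAddRel) : soloInformedSub c ∈ soloInformedScissorsRel := by
  obtain ⟨n, r, r₁, r₂, h₁, h₂, hadd, rfl⟩ := hc
  rw [map_sub, map_sub]
  exact soloInformed_sub_mem_scissorsRel_of_integrandAdd r r₁ r₂ h₁ h₂ hadd

/-! ### Assembly: density removal and `KontsevichZagierPeriods ↔ STABLE-H3` -/

/-- **DENSITY REMOVAL.**  `sub` maps `relations₁₂` (generated by the moves (1a), (1b), (2) of the KZ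
calculus) into the scissors-congruence subgroup `𝒮`. [this work, COROLLARY NF.2] -/
theorem soloInformed_densityRemoval : SoloInformedDensityRemoval := by
  intro x hx
  have hle : soloInformedEquidimRelations ≤ soloInformedScissorsRel.comap soloInformedSub := by
    rw [soloInformedEquidimRelations, AddSubgroup.closure_le]
    rintro c ((hc | hc) | hc)
    · exact soloInformed_sub_mem_scissorsRel_of_mem_domainAddRel hc
    · exact soloInformed_sub_mem_scissorsRel_of_mem_integrandAddRel hc
    · exact soloInformed_sub_mem_scissorsRel_of_mem_changeOfVariablesRel hc
  exact hle hx

/-- **COROLLARY NF.2 (kernel form): `KontsevichZagierPeriods ↔ STABLE-H3`.**  The Kontsevich–Zagier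
period conjecture holds iff any two volume representations (finite-volume compact-free unions of
`ℚ`-semialgebraic cells with integrand `1`) of equal volume become scissors congruent — congruent
modulo cutting along `ℚ`-semialgebraic sets and `ℚ`-semialgebraic injections with `|det| = 1` — after
multiplying both by some cube `[0,1]^k`. [this work, COROLLARY NF.2] -/
theorem soloInformed_summit_iff_stableH3 : KontsevichZagierPeriods ↔ SoloInformedStableH3 :=
  soloInformed_summit_iff_stableH3_of_densityRemoval soloInformed_densityRemoval

/-- `KontsevichZagierPeriods → STABLE-H3`. [this work, COROLLARY NF.2] -/
theorem soloInformed_stableH3_of_summit (h : KontsevichZagierPeriods) : SoloInformedStableH3 :=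
  soloInformed_summit_iff_stableH3.mp h

/-- The Literature form: `KZPeriodConjecture ↔ STABLE-H3`. [this work, COROLLARY NF.2] -/
theorem soloInformed_kzPeriodConjecture_iff_stableH3 :
    Literature.Periods.KZPeriodConjecture ↔ SoloInformedStableH3 :=
  soloInformed_summit_iff_stableH3

end Summit.KontsevichZagierPeriods.KontsevichZagierPeriods.Theorems

end
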